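import Literature.MeasureTheory.Group.FibreCountPullback
import Literature.MeasureTheory.Group.ConjugationFamilyFibres
import Literature.MeasureTheory.Group.InvariantOrbitMeasureUniqueness
import Literature.MeasureTheory.Group.InvariantQuotientExistence
import HarnessLib

/-!
# The Weyl integration formula on the `T`-regular set WITHOUT Jacobians, and its vanishing form
(Harish-Chandra (1970), Lemma 42; Weil (1965), n° 49 Lemme 22; Federer (1969), §2.10.10)

Topic `MeasureTheory/Group`; namespace `Literature.MeasureTheory.Group`.  Theorems only (no definition, no
named fact, no instance, no `sorry`).

SETTING.  `G` a locally compact, second countable Hausdorff group with a Haar measure `ν` which is also right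
invariant; `T ≤ G` a CLOSED ABELIAN subgroup with a Haar measure `tm` (inversion invariant), `μ₀ = ν ∕ tm` the
invariant quotient measure on `G ⧸ T` (★ `quotientMeasure`); `Φ : G ⧸ T × T → G` the CONJUGATION FAMILY
`Φ(xT, t) = x t x⁻¹` (a parameter pinned by this equation); `R ⊆ G` a conjugation-invariant Borel set («regular
elements») such that every `t ∈ T ∩ R` has centraliser EXACTLY `T`; `W = N_G(T) ∕ T` finite.  Write
`D = {(xT, t) | t ∈ R}` and `G^T = Φ(D) = ⋃_x x (T ∩ R) x⁻¹`.

Continues ★ `ConjugationFamilyFibres` (equivariance, local injectivity on `D`, fibre count `|W|` of `Φ`) and ★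
`FibreCountPullback` (Federer's multiplicity pull-back measure).

THE RESULTS (all PROVED).
* `fibreCount_conjFamily_smul_invariant`, `fibreCount_conjFamily_le` — the fibre-count pull-back `μ` of `ν` along
  `Φ` is `G`-invariant on rectangles and satisfies `μ(E) ≤ |W| ν(Φ(E ∩ D))` (finite on compact sets).
* `exists_radial_prod_eq_fibreCount_conjFamily` — `μ = (ν ∕ tm) ⊗ σ` for a Radon `σ` on `T` carried by `T ∩ R`.
* `exists_radialMeasure_lintegral_conjFamily` — **THE WEYL INTEGRATION FORMULA ON `G^T` WITH AN UNSPECIFIED RADIAL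
  MEASURE**: there is a measure `σ` on `T`, finite on compact sets and carried by `T ∩ R`, with
  `|W| · ∫_{G^T} f dν = ∫_T ∫_{G ⧸ T} f(x t x⁻¹) dμ₀(xT) dσ(t)` for every Borel `f ≥ 0` (classically
  `dσ = |D(t)| dt`, NOT asserted): `μ` is `G`-invariant by equivariance, so Weil's relative uniqueness on the single
  orbit `G ⧸ T` (★ `exists_measure_prod_eq_mul`) gives `μ = μ₀ ⊗ σ`, while `Φ_* μ = |W| · ν|_{G^T}`.
* `setIntegral_image_conjFamily_eq_zero` — **VANISHING FORM**: if `g` is `ν`-integrable on `G^T` and its orbital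
  integrals `∫_{G ⧸ T} g(x t x⁻¹) dμ₀` vanish for all `t ∈ T ∩ R`, then `∫_{G^T} g dν = 0`.
* `integral_eq_zero_of_forall_isOpen_setIntegral_eq_zero` — GLUING over tori: if `ν`-almost all of `G` is covered
  by OPEN sets, pairwise equal or disjoint, on each of which `g` integrates to zero, then `∫_G g dν = 0`.

WHY (the use).  With `G = H_v` a `p`-adic group, `R` the `G`-regular set (conull), `T` the centralisers of
regular elements and openness of `Φ` from submersivity of conjugation, this is the road to «a test function all of
whose regular orbital integrals vanish has Haar integral zero» [HarishChandra1970, Lemma 42; Rogawski1990, §12.5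
p. 182] with no Jacobian ∕ Weyl discriminant ever computed.

## References
* [HarishChandra1970] Harish-Chandra, *Harmonic analysis on reductive p-adic groups*, LNM 162 (1970), Lemma 42.
* [Weil1965] A. Weil, *Sur la formule de Siegel dans la théorie des groupes classiques*, Acta Math. 113 (1965),
  n° 49, Lemme 22.
* [Federer1969] H. Federer, *Geometric Measure Theory* (1969), §2.10.10.
* [DeitmarEchterhoff2014] A. Deitmar, S. Echterhoff, *Principles of Harmonic Analysis*, 2nd ed. (2014), Thm. 1.5.3.
-/

set_option autoImplicit false

noncomputable section

open MeasureTheory Measure Set Filter Topology Function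
open scoped ENNReal NNReal Pointwise

namespace Literature.MeasureTheory.Group

-- The quotient `G ⧸ T` carries the Borel σ-algebra supplied by the user as an instance ARGUMENT (local
-- instances take precedence over `QuotientGroup.measurableSpace`; idiom of `InvariantQuotientExistence`).

section Weyl

variable {G : Type*} [Group G] [TopologicalSpace G] [IsTopologicalGroup G] [LocallyCompactSpace G]
  [SecondCountableTopology G] [T2Space G] [MeasurableSpace G] [BorelSpace G]
  (T : Subgroup G) (hT : IsClosed (T : Set G)) (hTc : ∀ a ∈ T, ∀ b ∈ T, a * b = b * a)
  [MeasurableSpace (G ⧸ T)] [BorelSpace (G ⧸ T)]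
  (ν : Measure G) [ν.IsHaarMeasure] [ν.IsMulRightInvariant]
  (Φ : (G ⧸ T) × T → G) (hΦ : ∀ (x : G) (t : T), Φ (QuotientGroup.mk x, t) = x * t * x⁻¹)
  (R : Set G) (hRm : MeasurableSet R) (hRT : ∀ t : T, (t : G) ∈ R → Subgroup.centralizer {(t : G)} = T)
  (hRc : ∀ g x : G, x ∈ R → g * x * g⁻¹ ∈ R)
  (hW : (T.subgroupOf (Subgroup.normalizer (T : Set G))).index ≠ 0)

omit [MeasurableSpace G] [BorelSpace G] [MeasurableSpace (G ⧸ T)] [BorelSpace (G ⧸ T)] in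
include hT in
/-- `G ⧸ T × T` is Polish for a closed subgroup `T` of a locally compact second countable Hausdorff group (both
factors are). [cite: Kechris1995, Thm. 5.3] -/
theorem polishSpace_quotient_prod_subgroup : PolishSpace ((G ⧸ T) × T) := by
  haveI : IsClosed (T : Set G) := hT
  haveI : PolishSpace G :=
    Literature.Topology.Metrizable.polishSpace_of_locallyCompactSpace_of_secondCountableTopology G
  haveI : PolishSpace (G ⧸ T) :=
    Literature.Topology.Metrizable.polishSpace_of_locallyCompactSpace_of_secondCountableTopology _
  haveI : PolishSpace T := hT.polishSpace
  infer_instance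

omit [TopologicalSpace G] [IsTopologicalGroup G] [LocallyCompactSpace G] [SecondCountableTopology G] [T2Space G]
  [BorelSpace G] [BorelSpace (G ⧸ T)] in
include hRm in
/-- The `T`-regular part `D = {(xT, t) | t ∈ R}` of `G ⧸ T × T` is Borel. [cite: HarishChandra1970, Lemma 42] -/
theorem measurableSet_regularSet_conjFamily :
    MeasurableSet {p : (G ⧸ T) × T | ((p.2 : T) : G) ∈ R} :=
  (measurable_subtype_coe.comp measurable_snd) hRm

omit [LocallyCompactSpace G] [SecondCountableTopology G] [T2Space G] [MeasurableSpace G] [BorelSpace G]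
  [MeasurableSpace (G ⧸ T)] [BorelSpace (G ⧸ T)] in
include hT hTc hΦ hRT hW in
/-- Local injectivity of `Φ` on `D` in the hypothesis shape of ★ `FibreCountPullback`. [cite: HarishChandra1970, Lemma 42] -/
theorem locallyInjOn_conjFamily : ∀ z ∈ {p : (G ⧸ T) × T | ((p.2 : T) : G) ∈ R}, ∃ U : Set ((G ⧸ T) × T),
    IsOpen U ∧ z ∈ U ∧ InjOn Φ (U ∩ {p : (G ⧸ T) × T | ((p.2 : T) : G) ∈ R}) :=
  fun z _ => exists_isOpen_injOn_conjFamily T hT hTc Φ hΦ R hRT hW z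

include hT hTc hΦ hRm hRT hW in
/-- **Conjugation invariance of the fibre-count pull-back** of the Haar measure `ν` along `Φ`: for every `c ∈ G`
and Borel rectangle `A ×ˢ B ⊆ G ⧸ T × T`, `μ((c⁻¹ • A) ×ˢ B) = μ(A ×ˢ B)` — equivariance `Φ(c • q, t) = c Φ(q,t) c⁻¹`
(★ `apply_preimage_eq_of_semiconj`) and conjugation invariance of `ν`. [cite: HarishChandra1970, Lemma 42]
[cite: Federer1969, §2.10.10] -/
theorem fibreCount_conjFamily_smul_invariant {μ : Measure ((G ⧸ T) × T)}
    (hμ : ∀ E : Set ((G ⧸ T) × T), MeasurableSet E →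
      μ E = ∫⁻ y, Measure.count (Φ ⁻¹' {y} ∩ (E ∩ {p : (G ⧸ T) × T | ((p.2 : T) : G) ∈ R})) ∂ν)
    (c : G) {A : Set (G ⧸ T)} (hA : MeasurableSet A) {B : Set T} (hB : MeasurableSet B) :
    μ (((c • ·) ⁻¹' A) ×ˢ B) = μ (A ×ˢ B) := by
  haveI : IsClosed (T : Set G) := hT
  haveI : PolishSpace ((G ⧸ T) × T) := polishSpace_quotient_prod_subgroup T hT
  have hDm := measurableSet_regularSet_conjFamily T R hRm
  have hΦc : Continuous Φ := (continuous_conjFamily_and_smul T Φ hΦ).1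
  have hinj := locallyInjOn_conjFamily T hT hTc Φ hΦ R hRT hW
  -- the two bijections
  set α : ((G ⧸ T) × T) ≃ ((G ⧸ T) × T) := (MulAction.toPerm c : (G ⧸ T) ≃ (G ⧸ T)).prodCongr (Equiv.refl T)
    with hα
  set β : G ≃ G := (MulAut.conj c).toEquiv with hβ
  have hαm : Measurable α := by
    rw [hα, Equiv.prodCongr_apply]
    exact (measurable_const_smul c).prodMap measurable_id
  have hβm : Measurable β := (by fun_prop : Measurable fun x : G => c * x * c⁻¹)
  have hcomm : ∀ z, Φ (α z) = β (Φ z) := by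
    rintro ⟨q, t⟩
    change Φ (c • q, t) = c * Φ (q, t) * c⁻¹
    exact conjFamily_smul T Φ hΦ c q t
  have hαD : ∀ z : (G ⧸ T) × T, α z ∈ {p : (G ⧸ T) × T | ((p.2 : T) : G) ∈ R} ↔
      z ∈ {p : (G ⧸ T) × T | ((p.2 : T) : G) ∈ R} := fun _ => Iff.rfl
  have hν : ν.map β = ν := by
    have : (β : G → G) = (fun x => x * c⁻¹) ∘ (fun x => c * x) := by
      funext x; change c * x * c⁻¹ = c * x * c⁻¹; rfl
    rw [this, ← Measure.map_map (measurable_mul_const c⁻¹) (measurable_const_mul c), map_mul_left_eq_self,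
      map_mul_right_eq_self]
  have key := apply_preimage_eq_of_semiconj hDm hΦc hinj hμ α β hαm hβm hcomm hαD hν (hA.prod hB)
  have hpre : α ⁻¹' (A ×ˢ B) = ((c • ·) ⁻¹' A) ×ˢ B := by
    ext ⟨q, t⟩
    simp only [hα, mem_preimage, Equiv.prodCongr_apply, Prod.map_apply, Equiv.coe_refl, id_eq, mem_prod,
      MulAction.toPerm_apply]
  rw [← hpre, key]

omit [ν.IsHaarMeasure] [ν.IsMulRightInvariant] in
include hT hTc hΦ hRm hRT hRc hW in
/-- **Mass bound** for the fibre-count pull-back of `ν` along `Φ`: `μ(E) ≤ |W| · ν(Φ(E ∩ D))`; in particular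
`μ` is finite on compact sets. [cite: Federer1969, §2.10.10] [cite: HarishChandra1970, Lemma 42] -/
theorem fibreCount_conjFamily_le {μ : Measure ((G ⧸ T) × T)}
    (hμ : ∀ E : Set ((G ⧸ T) × T), MeasurableSet E →
      μ E = ∫⁻ y, Measure.count (Φ ⁻¹' {y} ∩ (E ∩ {p : (G ⧸ T) × T | ((p.2 : T) : G) ∈ R})) ∂ν)
    {E : Set ((G ⧸ T) × T)} (hE : MeasurableSet E) :
    μ E ≤ ((T.subgroupOf (Subgroup.normalizer (T : Set G))).index : ℝ≥0∞) *
      ν (Φ '' (E ∩ {p : (G ⧸ T) × T | ((p.2 : T) : G) ∈ R})) := by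
  haveI : IsClosed (T : Set G) := hT
  haveI : PolishSpace ((G ⧸ T) × T) := polishSpace_quotient_prod_subgroup T hT
  have hDm := measurableSet_regularSet_conjFamily T R hRm
  have hΦc : Continuous Φ := (continuous_conjFamily_and_smul T Φ hΦ).1
  have hinj := locallyInjOn_conjFamily T hT hTc Φ hΦ R hRT hW
  refine apply_le_mul_measure_image hDm hΦc hinj hμ (fun y => ?_) hE
  by_cases hy : y ∈ Φ '' {p : (G ⧸ T) × T | ((p.2 : T) : G) ∈ R}
  · exact (count_fibre_conjFamily_eq T hTc Φ hΦ R hRT hRc hW hy).le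
  · have : Φ ⁻¹' {y} ∩ {p : (G ⧸ T) × T | ((p.2 : T) : G) ∈ R} = ∅ := by
      ext z
      simp only [mem_inter_iff, mem_preimage, mem_singleton_iff, mem_setOf_eq, mem_empty_iff_false, iff_false,
        not_and]
      exact fun hz hzR => hy ⟨z, hzR, hz⟩
    rw [this, measure_empty]
    exact zero_le

variable (tm : Measure T) [tm.IsMulLeftInvariant] [IsFiniteMeasureOnCompacts tm] [tm.IsOpenPosMeasure]
  [tm.IsInvInvariant]

include hT hTc hΦ hRm hRT hRc hW in
/-- **Weil factorisation of the fibre-count pull-back**: the pull-back `μ` of `ν` along `Φ` is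
`(ν ∕ tm) ⊗ σ` for a measure `σ` on `T` which is finite on compact sets and carried by `T ∩ R` — `μ` is
`G`-invariant on rectangles and `G ⧸ T` is a single orbit, so Weil's relative uniqueness
(★ `exists_measure_prod_eq_mul`) applies. [cite: Weil1965, n° 49 Lemme 22 (p. 70)] [cite: HarishChandra1970, Lemma 42] -/
theorem exists_radial_prod_eq_fibreCount_conjFamily {μ : Measure ((G ⧸ T) × T)}
    (hμ : ∀ E : Set ((G ⧸ T) × T), MeasurableSet E →
      μ E = ∫⁻ y, Measure.count (Φ ⁻¹' {y} ∩ (E ∩ {p : (G ⧸ T) × T | ((p.2 : T) : G) ∈ R})) ∂ν) :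
    ∃ σ : Measure T, IsFiniteMeasureOnCompacts σ ∧ SigmaFinite σ ∧ σ {t : T | (t : G) ∉ R} = 0 ∧
      (quotientMeasure T tm hT ν).prod σ = μ := by
  classical
  haveI : IsClosed (T : Set G) := hT
  haveI : LocallyCompactSpace T := hT.locallyCompactSpace
  haveI : SecondCountableTopology T := TopologicalSpace.Subtype.secondCountableTopology _
  haveI : SigmaCompactSpace T := sigmaCompactSpace_of_locallyCompact_secondCountable
  set w : ℝ≥0∞ := ((T.subgroupOf (Subgroup.normalizer (T : Set G))).index : ℝ≥0∞) with hw
  have hwtop : w ≠ ⊤ := ENNReal.natCast_ne_top _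
  set D : Set ((G ⧸ T) × T) := {p : (G ⧸ T) × T | ((p.2 : T) : G) ∈ R} with hD
  set S : Set T := {t : T | (t : G) ∈ R} with hS
  have hSm : MeasurableSet S := measurable_subtype_coe hRm
  have hΦc : Continuous Φ := (continuous_conjFamily_and_smul T Φ hΦ).1
  -- reference measure on the single orbit `G ⧸ T`
  set μ₀ : Measure (G ⧸ T) := quotientMeasure T tm hT ν with hμ₀
  haveI : SMulInvariantMeasure G (G ⧸ T) μ₀ := smulInvariantMeasure_quotientMeasure T tm hT ν
  have hμ₀ne : μ₀ ≠ 0 := quotientMeasure_ne_zero T tm hT ν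
  obtain ⟨A₀, hA₀c, hA₀⟩ := (Measure.Regular.exists_isCompact_not_null (μ := μ₀)).2 hμ₀ne
  have hA₀top : μ₀ A₀ ≠ ⊤ := hA₀c.measure_lt_top.ne
  -- finiteness of `μ` on compact rectangles
  have hfinK : ∀ K : Set ((G ⧸ T) × T), IsCompact K → μ K < ⊤ := by
    intro K hK
    refine (fibreCount_conjFamily_le T hT hTc ν Φ hΦ R hRm hRT hRc hW hμ hK.measurableSet).trans_lt ?_
    refine ENNReal.mul_lt_top hwtop.lt_top ?_
    exact (measure_mono (image_mono inter_subset_left)).trans_lt ((hK.image hΦc).measure_lt_top)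
  -- `μ` only sees `D`
  have hμD : ∀ (A : Set (G ⧸ T)) (B : Set T), MeasurableSet A → MeasurableSet B →
      μ (A ×ˢ B) = μ (A ×ˢ (B ∩ S)) := by
    intro A B hA hB
    have h0 : μ (A ×ˢ (B \ S)) = 0 := by
      refine apply_eq_zero_of_inter_eq_empty hμ (hA.prod (hB.diff hSm)) ?_
      rw [Set.eq_empty_iff_forall_notMem]
      rintro ⟨q, t⟩ ⟨⟨-, ht⟩, ht'⟩
      exact ht.2 ht'
    have hdisj : Disjoint (A ×ˢ (B ∩ S)) (A ×ˢ (B \ S)) :=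
      Set.disjoint_prod.2 (Or.inr disjoint_sdiff_inter.symm)
    calc μ (A ×ˢ B) = μ (A ×ˢ (B ∩ S) ∪ A ×ˢ (B \ S)) := by rw [← Set.prod_union, inter_union_sdiff]
      _ = μ (A ×ˢ (B ∩ S)) + μ (A ×ˢ (B \ S)) := measure_union hdisj (hA.prod (hB.diff hSm))
      _ = μ (A ×ˢ (B ∩ S)) := by rw [h0, add_zero]
  -- the radial measure
  set σ : Measure T := (μ₀ A₀)⁻¹ • ((μ.restrict (A₀ ×ˢ univ)).map Prod.snd) with hσ
  have hσB : ∀ B : Set T, MeasurableSet B → σ B = (μ₀ A₀)⁻¹ * μ (A₀ ×ˢ B) := by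
    intro B hB
    rw [hσ, Measure.smul_apply, smul_eq_mul, Measure.map_apply measurable_snd hB,
      Measure.restrict_apply (measurable_snd hB)]
    congr 2
    ext ⟨q, t⟩
    simp only [mem_inter_iff, mem_preimage, mem_prod, mem_univ, and_true]
    exact and_comm
  have hσfin : IsFiniteMeasureOnCompacts σ := by
    refine ⟨fun K hK => ?_⟩
    rw [hσB K hK.measurableSet]
    exact ENNReal.mul_lt_top (ENNReal.inv_lt_top.2 (pos_iff_ne_zero.2 hA₀)) (hfinK _ (hA₀c.prod hK))
  have hσS : σ {t : T | (t : G) ∉ R} = 0 := by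
    have hm : MeasurableSet {t : T | (t : G) ∉ R} := hSm.compl
    rw [hσB _ hm, hμD A₀ _ hA₀c.measurableSet hm]
    have : {t : T | (t : G) ∉ R} ∩ S = ∅ := by
      ext t; simp [hS]
    rw [this, Set.prod_empty, measure_empty, mul_zero]
  -- Weil's relative uniqueness on bounded regular `B`
  have hrect_bdd : ∀ (B : Set T), MeasurableSet B → (∃ K : Set T, IsCompact K ∧ B ⊆ K) →
      ∀ A : Set (G ⧸ T), MeasurableSet A → μ (A ×ˢ B) = μ₀ A * σ B := by
    intro B hB hBK A hA
    obtain ⟨K, hK, hBK⟩ := hBK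
    have hμ₀c : μ₀ (MulAction.orbit G (QuotientGroup.mk (1 : G) : G ⧸ T))ᶜ = 0 := by
      rw [MulAction.orbit_eq_univ, compl_univ, measure_empty]
    have hfin : ∀ K' : Set (G ⧸ T), IsCompact K' → μ (K' ×ˢ B) < ⊤ := fun K' hK' =>
      (measure_mono (prod_mono_right hBK)).trans_lt (hfinK _ (hK'.prod hK))
    have hinv : ∀ (c : G) (A' : Set (G ⧸ T)), MeasurableSet A' → μ (((c • ·) ⁻¹' A') ×ˢ B) = μ (A' ×ˢ B) :=
      fun c A' hA' => fibreCount_conjFamily_smul_invariant T hT hTc ν Φ hΦ R hRm hRT hW hμ c hA' hB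
    have hcar : μ ((MulAction.orbit G (QuotientGroup.mk (1 : G) : G ⧸ T))ᶜ ×ˢ B) = 0 := by
      rw [MulAction.orbit_eq_univ, compl_univ, Set.empty_prod, measure_empty]
    obtain ⟨c, hc⟩ := exists_measure_prod_eq_mul G (QuotientGroup.mk (1 : G) : G ⧸ T) μ₀ μ hμ₀c hμ₀ne hfin
      hinv hcar
    have hcσ : σ B = c := by
      rw [hσB B hB, hc A₀ hA₀c.measurableSet, ← mul_assoc, mul_comm ((μ₀ A₀)⁻¹), mul_assoc,
        ENNReal.inv_mul_cancel hA₀ hA₀top, mul_one]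
    rw [hc A hA, hcσ, mul_comm]
  -- all rectangles, by exhaustion of `T` by compact sets
  have hrect : ∀ (A : Set (G ⧸ T)) (B : Set T), MeasurableSet A → MeasurableSet B → μ (A ×ˢ B) = μ₀ A * σ B := by
    intro A B hA hB
    have hσsplit : σ B = σ (B ∩ S) := by
      have h0 : σ (B \ S) = 0 := measure_mono_null (fun t ht => ht.2) hσS
      calc σ B = σ (B ∩ S ∪ B \ S) := by rw [inter_union_sdiff]
        _ = σ (B ∩ S) + σ (B \ S) := measure_union disjoint_sdiff_inter.symm (hB.diff hSm)
        _ = σ (B ∩ S) := by rw [h0, add_zero]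
    rw [hμD A B hA hB, hσsplit]
    -- exhaust `B ∩ S` by the compact covering of `T`
    set Bn : ℕ → Set T := fun n => B ∩ S ∩ compactCovering T n with hBn
    have hBn_mono : Monotone Bn := fun m n hmn => inter_subset_inter_right _ (compactCovering_subset T hmn)
    have hBn_union : (⋃ n, Bn n) = B ∩ S := by
      rw [hBn, ← inter_iUnion, iUnion_compactCovering, inter_univ]
    have h1 : μ (A ×ˢ (B ∩ S)) = ⨆ n, μ (A ×ˢ Bn n) := by
      rw [← hBn_union, Set.prod_iUnion]
      exact (monotone_const.set_prod hBn_mono).measure_iUnion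
    have h2 : σ (B ∩ S) = ⨆ n, σ (Bn n) := by
      rw [← hBn_union]
      exact hBn_mono.measure_iUnion
    rw [h1, h2, ENNReal.mul_iSup]
    refine iSup_congr fun n => ?_
    exact hrect_bdd (Bn n) ((hB.inter hSm).inter (isCompact_compactCovering T n).measurableSet)
      ⟨compactCovering T n, isCompact_compactCovering T n, inter_subset_right⟩ A hA
  haveI := hσfin
  haveI hσsf : SigmaFinite σ := SigmaFinite.of_isFiniteMeasureOnCompacts σ
  refine ⟨σ, hσfin, hσsf, hσS, Measure.prod_eq fun A B hA hB => (hrect A B hA hB)⟩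

include hTc hΦ hRT hRc hW hRm in
/-- **THE WEYL INTEGRATION FORMULA ON THE `T`-REGULAR SET, WITH AN UNSPECIFIED RADIAL MEASURE.**  For a closed abelian
subgroup `T` with finite Weyl group, a conjugation-invariant Borel `R` on which centralisers of elements of `T` are
exactly `T`, and the conjugation family `Φ(xT, t) = x t x⁻¹`: there is a measure `σ` on `T`, finite on compact
sets and carried by `T ∩ R`, such that for every Borel `f ≥ 0` on `G`
`|N_G(T)∕T| · ∫_{Φ(D)} f dν = ∫_T ∫_{G ⧸ T} f(x t x⁻¹) d(ν∕tm)(xT) dσ(t)`, `D = {(xT, t) | t ∈ R}`.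
(Classically `dσ = |D(t)| dt`; no Jacobian is computed here.) [cite: HarishChandra1970, Lemma 42]
[cite: Weil1965, n° 49 Lemme 22 (p. 70)] [cite: Federer1969, §2.10.10] -/
theorem exists_radialMeasure_lintegral_conjFamily :
    ∃ σ : Measure T, IsFiniteMeasureOnCompacts σ ∧ SigmaFinite σ ∧ σ {t : T | (t : G) ∉ R} = 0 ∧
      ∀ f : G → ℝ≥0∞, Measurable f →
        ((T.subgroupOf (Subgroup.normalizer (T : Set G))).index : ℝ≥0∞) *
            ∫⁻ y in Φ '' {p : (G ⧸ T) × T | ((p.2 : T) : G) ∈ R}, f y ∂ν =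
          ∫⁻ t, ∫⁻ q, f (Φ (q, t)) ∂(quotientMeasure T tm hT ν) ∂σ := by
  haveI : IsClosed (T : Set G) := hT
  haveI : PolishSpace ((G ⧸ T) × T) := polishSpace_quotient_prod_subgroup T hT
  have hDm := measurableSet_regularSet_conjFamily T R hRm
  have hΦc : Continuous Φ := (continuous_conjFamily_and_smul T Φ hΦ).1
  have hinj := locallyInjOn_conjFamily T hT hTc Φ hΦ R hRT hW
  obtain ⟨μ, hμ⟩ := exists_measure_apply_eq_lintegral_count_fibre hDm hΦc hinj ν
  have hw : ∀ y ∈ Φ '' {p : (G ⧸ T) × T | ((p.2 : T) : G) ∈ R},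
      Measure.count (Φ ⁻¹' {y} ∩ {p : (G ⧸ T) × T | ((p.2 : T) : G) ∈ R}) =
        ((T.subgroupOf (Subgroup.normalizer (T : Set G))).index : ℝ≥0∞) :=
    fun y hy => count_fibre_conjFamily_eq T hTc Φ hΦ R hRT hRc hW hy
  obtain ⟨σ, hσfin, hσsf, hσS, hprod⟩ :=
    exists_radial_prod_eq_fibreCount_conjFamily T hT hTc ν Φ hΦ R hRm hRT hRc hW tm hμ
  haveI := hσfin
  haveI := hσsf
  refine ⟨σ, hσfin, hσsf, hσS, fun f hf => ?_⟩
  rw [← lintegral_comp_eq_mul_setLIntegral_image hDm hΦc hinj hμ hw hf, ← hprod,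
    lintegral_prod_symm (fun z : (G ⧸ T) × T => f (Φ z)) (hf.comp hΦc.measurable).aemeasurable]

include hTc hΦ hRT hRc hW hRm in
/-- **VANISHING FORM OF THE WEYL INTEGRATION FORMULA ON THE `T`-REGULAR SET.**  If `g : G → E` is `ν`-integrable on
`Φ(D) = ⋃_x x (T ∩ R) x⁻¹` and all its orbital integrals `∫_{G ⧸ T} g(x t x⁻¹) d(ν∕tm)(xT)`, `t ∈ T ∩ R`, vanish,
then `∫_{Φ(D)} g dν = 0`. [cite: HarishChandra1970, Lemma 42] [cite: Weil1965, n° 49 Lemme 22 (p. 70)] -/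
theorem setIntegral_image_conjFamily_eq_zero {E : Type*} [NormedAddCommGroup E] [NormedSpace ℝ E]
    (g : G → E) (hg : IntegrableOn g (Φ '' {p : (G ⧸ T) × T | ((p.2 : T) : G) ∈ R}) ν)
    (h0 : ∀ t : T, (t : G) ∈ R → ∫ q, g (Φ (q, t)) ∂(quotientMeasure T tm hT ν) = 0) :
    ∫ y in Φ '' {p : (G ⧸ T) × T | ((p.2 : T) : G) ∈ R}, g y ∂ν = 0 := by
  haveI : IsClosed (T : Set G) := hT
  haveI : PolishSpace ((G ⧸ T) × T) := polishSpace_quotient_prod_subgroup T hT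
  have hDm := measurableSet_regularSet_conjFamily T R hRm
  have hΦc : Continuous Φ := (continuous_conjFamily_and_smul T Φ hΦ).1
  have hinj := locallyInjOn_conjFamily T hT hTc Φ hΦ R hRT hW
  obtain ⟨μ, hμ⟩ := exists_measure_apply_eq_lintegral_count_fibre hDm hΦc hinj ν
  set w : ℝ≥0∞ := ((T.subgroupOf (Subgroup.normalizer (T : Set G))).index : ℝ≥0∞) with hwdef
  have hwtop : w ≠ ⊤ := ENNReal.natCast_ne_top _
  have hw0 : w.toReal ≠ 0 := by
    rw [hwdef, ENNReal.toReal_natCast]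
    exact_mod_cast hW
  have hw : ∀ y ∈ Φ '' {p : (G ⧸ T) × T | ((p.2 : T) : G) ∈ R},
      Measure.count (Φ ⁻¹' {y} ∩ {p : (G ⧸ T) × T | ((p.2 : T) : G) ∈ R}) = w :=
    fun y hy => count_fibre_conjFamily_eq T hTc Φ hΦ R hRT hRc hW hy
  have hmap := map_eq_smul_restrict_image_of_count_fibre_eq hDm hΦc hinj hμ hw
  obtain ⟨σ, hσfin, hσsf, hσS, hprod⟩ :=
    exists_radial_prod_eq_fibreCount_conjFamily T hT hTc ν Φ hΦ R hRm hRT hRc hW tm hμ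
  haveI := hσfin
  haveI := hσsf
  -- `g ∘ Φ` is `μ`-integrable and `∫ g ∘ Φ dμ = w • ∫_{Φ D} g dν`
  have hgm : AEStronglyMeasurable g (μ.map Φ) := by
    rw [hmap]; exact hg.aestronglyMeasurable.smul_measure _
  have hint : Integrable (g ∘ Φ) μ := by
    rw [← integrable_map_measure hgm hΦc.measurable.aemeasurable, hmap]
    exact hg.integrable.smul_measure hwtop
  have h1 : ∫ z, g (Φ z) ∂μ = w.toReal • ∫ y in Φ '' {p : (G ⧸ T) × T | ((p.2 : T) : G) ∈ R}, g y ∂ν := by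
    rw [← integral_map hΦc.measurable.aemeasurable hgm, hmap, integral_smul_measure]
  -- and by Fubini it vanishes
  have h2 : ∫ z, g (Φ z) ∂μ = 0 := by
    rw [← hprod] at hint ⊢
    rw [integral_prod_symm (fun z : (G ⧸ T) × T => g (Φ z)) hint]
    have hae : ∀ᵐ t : T ∂σ, ((t : T) : G) ∈ R := by
      filter_upwards [measure_eq_zero_iff_ae_notMem.1 hσS] with t ht
      simpa using ht
    calc ∫ t, ∫ q, g (Φ (q, t)) ∂(quotientMeasure T tm hT ν) ∂σ = ∫ t, (0 : E) ∂σ := by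
          refine integral_congr_ae ?_
          filter_upwards [hae] with t ht
          exact h0 t ht
      _ = 0 := integral_zero _ _
  rw [h2] at h1
  exact (smul_eq_zero.1 h1.symm).resolve_left hw0

end Weyl

section Glue

variable {G : Type*} [MeasurableSpace G] [TopologicalSpace G] [SecondCountableTopology G] [OpensMeasurableSpace G]
  {E : Type*} [NormedAddCommGroup E] [NormedSpace ℝ E]

/-- **Gluing the tori (Lindelöf + disjointification).**  If `ν`-almost all of `G` is covered by a family of OPEN
sets `P i` which are pairwise equal or disjoint, and an integrable `g` has `∫_{P i} g dν = 0` for every `i`, then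
`∫_G g dν = 0`: countably many `P i` suffice (second countability), and discarding repetitions makes them
pairwise disjoint without changing the family of sets. [cite: HarishChandra1970, Lemma 42] -/
theorem integral_eq_zero_of_forall_isOpen_setIntegral_eq_zero {ι : Type*} (ν : Measure G) (P : ι → Set G)
    (hPo : ∀ i, IsOpen (P i)) (hPd : ∀ i j, P i = P j ∨ Disjoint (P i) (P j))
    (hcov : ν (⋃ i, P i)ᶜ = 0) (g : G → E) (hg : Integrable g ν)
    (h0 : ∀ i, ∫ y in P i, g y ∂ν = 0) : ∫ y, g y ∂ν = 0 := by
  classical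
  obtain ⟨C, hCc, hCU⟩ := TopologicalSpace.isOpen_iUnion_countable P hPo
  -- the distinct members of the countable subfamily, as a countable set of sets
  set PC : Set (Set G) := P '' C with hPC
  have hPCc : PC.Countable := hCc.image P
  haveI : Countable PC := hPCc.to_subtype
  have hPCU : (⋃ s : PC, (s : Set G)) = ⋃ i, P i := by
    rw [← Set.sUnion_eq_iUnion, hPC, Set.sUnion_image, hCU]
  have hPCd : Pairwise (Disjoint on (Subtype.val : PC → Set G)) := by
    refine (pairwise_subtype_iff_pairwise_set PC Disjoint).2 ?_
    rintro _ ⟨i, -, rfl⟩ _ ⟨j, -, rfl⟩ hne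
    exact (hPd i j).resolve_left hne
  have hPCm : ∀ s : PC, MeasurableSet (s : Set G) := by
    rintro ⟨_, i, -, rfl⟩; exact (hPo i).measurableSet
  have hPC0 : ∀ s : PC, ∫ y in (s : Set G), g y ∂ν = 0 := by
    rintro ⟨_, i, -, rfl⟩; exact h0 i
  -- `∫_G g = ∫_{⋃ PC} g = Σ_{s ∈ PC} ∫_s g = 0`
  have hU : ∫ y, g y ∂ν = ∫ y in ⋃ s : PC, (s : Set G), g y ∂ν := by
    have h1 : ∫ y in ⋃ i, P i, g y ∂ν = ∫ y in univ, g y ∂ν := setIntegral_congr_set (ae_eq_univ.2 hcov)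
    rw [hPCU, h1, Measure.restrict_univ]
  rw [hU, integral_iUnion hPCm hPCd hg.integrableOn]
  simp [hPC0]

end Glue

end Literature.MeasureTheory.Group

end
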